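import Summits.BirchSwinnertonDyer.BirchSwinnertonDyer.Theorems.ManinLocalTwoThreeManinConstantFourHundredCE
import Summits.BirchSwinnertonDyer.BirchSwinnertonDyer.Theorems.ManinLocalTwoThreeRootFormsFifty
import Summits.BirchSwinnertonDyer.BirchSwinnertonDyer.Theorems.ManinLocalTwoThreeNeronSqueeze
import Summits.BirchSwinnertonDyer.BirchSwinnertonDyer.Theorems.Rank2ObservatoryKrausCert
import Summits.BirchSwinnertonDyer.Rank1Residual.Additive.IntModelTamagawaCertificate
import Summits.BirchSwinnertonDyer.Rank1Residual.ManinAdditive.HalfTranslateTwistStep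
import Literature.NumberTheory.EllipticCurves.Gamma1PeriodLatticeTwistProofs
import Literature.NumberTheory.EllipticCurves.ManinConstantQuadraticTwistAtTwoProofs
import Literature.NumberTheory.EllipticCurves.QuadraticTwistNegOneLFunctionProofs
import HarnessLib

/-!
# Level 400 = 2⁴·5², the classes `50a ⊗ χ₋₄` (`a₃ = −1`) and `50b ⊗ χ₋₄` (`a₃ = 1`): `|c| = 1` UNCONDITIONALLY by the datum-free roots `φ₅₀ₐ, φ₅₀ᵦ`
# on `Γ₀(100)` and the `r = ½` Néron twist identity — with `…FourHundredCE`, FOUR of the eight classes of level 400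

Cell bsd-f2-manin, route `ManinLocalTwoThree` (crux C2 `ManinOddAtFour`, stmt-BirchSwinnertonDyer-22967; `--supports` helper), LEAD p1 gen 27.
* §1 rows `D`/`F` of an g57's pinning re-rooted at `100` (`D.f = φ₅₀ₐ|₁₀₀ ⊗ χ₋₄` iff `a₃(W) = −1`, `= φ₅₀ᵦ|₁₀₀ ⊗ χ₋₄` iff `a₃(W) = 1`; depth `145 ≥ 144`);
* §2 ALIGNED MINIMAL MODELS `C_d = [0, -1, 0, -8, 112]` (`= ⟨½,0,0,0⟩ • 50a1^(−1)`), `C_f = [0, 1, 0, -48, -172]` (`= ⟨½,1/2,0,0⟩ • 50b1^(−1)`), `(½)¹²Δ_C = Δ_root`, Kraus-minimal;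
* §3 the `r = ½` transport at `M = 100` (roots MULTIPLICATIVE at `2`; Stevens (5.4) + Pal + p3's Néron squeeze; the 176b/208a,d recipe);
* §4 `abs_maninConstant_eq_one_fourHundred_of_rowCDEF` (`a₃ ∈ {−1, 0, 1}` or `(a₃,a₇) = (−2,2)`), `2 ∤ c`, `5 ∤ c` there.
HONEST FRAMING: unconditional (standard axioms); FOUR of eight classes (the pairs `a₃ = ∓3` and the `200b`-rooted pair stay open); no root datum, no modularity,
no CDT, no printed Manin fact; nothing here proves C2/C3, Manin's conjecture or BSD.  No named fact, no sorry.
[cite: Stevens1989, Lemma (5.4) p. 97] [cite: Pal2012, Prop. 2.4, Lemma 3.1] [cite: AgasheRibetStein2006, §§1–2] [cite: Kraus1989, Prop. 2]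
[cite: CremonaAlgorithms1997, §2.10, Table 1 (50a1, 50b1; N = 400)] [cite: Shimura1971, Prop. 3.64]
-/

set_option autoImplicit false
-- lint-debt: the directory name repeats the summit name (sibling precedent `ManinLocalTwoThreeManinConstantFourHundredCE.lean`)
set_option linter.dupNamespace false

noncomputable section

open Complex WeierstrassCurve
open UpperHalfPlane hiding I
open scoped MatrixGroups ModularForm
open ModularForm CongruenceSubgroup PowerSeries
open Literature.NumberTheory.ModularForms
open Literature.NumberTheory.EllipticCurves Literature.NumberTheory.EllipticCurves.ModularForms

namespace Summit.BirchSwinnertonDyer.BirchSwinnertonDyer.Theorems.ManinLocalTwoThree.LevelFourHundred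

open Summit.BirchSwinnertonDyer.BirchSwinnertonDyer.Theorems.ManinLocalTwoThree
open Summit.BirchSwinnertonDyer.BirchSwinnertonDyer.Theorems
open Summit.BirchSwinnertonDyer.BirchSwinnertonDyer.Rank2Observatory
open Summit.BirchSwinnertonDyer.Rank1Residual.Additive
open Summit.BirchSwinnertonDyer.Rank1Residual.ManinAdditive
open BracketSturm PinningKernel PinningFourHundred

set_option maxHeartbeats 4000000
set_option maxRecDepth 16384

variable {W : WeierstrassCurve ℚ} [W.IsElliptic]

/-! ## §1 The rows `d`, `f`, re-rooted at level `100` -/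

/-- `χ₋₄(n)·aₙ(φ₅₀ₐ)` to depth `145` — the row `a₃ = −1`. [cite: CremonaAlgorithms1997, Table 1 (N = 400)] -/
def tabTD : List ℤ :=
  [0, 1, 0, -1, 0, 0, 0, -2, 0, -2, 0, 3, 0, -4, 0, 0, 0, -3, 0, -5, 0, 2, 0, -6, 0, 0, 0, 5, 0, 0, 0, -2, 0, -3, 0, 0, 0, 2, 0, 4, 0, -3, 0, 4, 0,
  0, 0, -12, 0, -3, 0, 3, 0, 6, 0, 0, 0, 5, 0, 0, 0, 2, 0, 4, 0, 0, 0, 13, 0, 6, 0, -12, 0, 11, 0, 0, 0, -6, 0, 10, 0, 1, 0, 9, 0, 0, 0, 0, 0, 15, 0,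
  8, 0, 2, 0, 0, 0, 2, 0, -6, 0, -18, 0, 4, 0, 0, 0, 3, 0, -10, 0, -2, 0, -9, 0, 0, 0, 8, 0, 6, 0, -2, 0, 3, 0, 0, 0, -2, 0, -4, 0, -12, 0, 10, 0, 0,
  0, -3, 0, -5, 0, 12, 0, -12, 0]

/-- `χ₋₄(n)·aₙ(φ₅₀ᵦ)` to depth `145` — the row `a₃ = 1`. [cite: CremonaAlgorithms1997, Table 1 (N = 400)] -/
def tabTF : List ℤ :=
  [0, 1, 0, 1, 0, 0, 0, 2, 0, -2, 0, 3, 0, 4, 0, 0, 0, 3, 0, -5, 0, 2, 0, 6, 0, 0, 0, -5, 0, 0, 0, -2, 0, 3, 0, 0, 0, -2, 0, 4, 0, -3, 0, -4, 0, 0,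
  0, 12, 0, -3, 0, 3, 0, -6, 0, 0, 0, -5, 0, 0, 0, 2, 0, -4, 0, 0, 0, -13, 0, 6, 0, -12, 0, -11, 0, 0, 0, 6, 0, 10, 0, 1, 0, -9, 0, 0, 0, 0, 0, 15,
  0, 8, 0, -2, 0, 0, 0, -2, 0, -6, 0, -18, 0, -4, 0, 0, 0, -3, 0, -10, 0, -2, 0, 9, 0, 0, 0, -8, 0, 6, 0, -2, 0, -3, 0, 0, 0, 2, 0, -4, 0, -12, 0,
  -10, 0, 0, 0, 3, 0, -5, 0, 12, 0, 12, 0]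

/-- `tabTD[n] = χ₋₄(n)·RootFormsFifty.t50a[n]`, `n < 145`. [folklore] -/
theorem hTwD : ∀ n < 145, tabTD.getD n 0 = ZMod.χ₄ n * RootFormsFifty.t50a.getD n 0 := by
  decide +kernel

/-- `tabTF[n] = χ₋₄(n)·RootFormsFifty.t50b[n]`, `n < 145`. [folklore] -/
theorem hTwF : ∀ n < 145, tabTF.getD n 0 = ZMod.χ₄ n * RootFormsFifty.t50b.getD n 0 := by
  decide +kernel

/-- **Row identity `d`.** [folklore] -/
theorem hrowD : ∀ n < 145, rowD.2.1 * tabTD.getD n 0 = ∑ j : Fin 43, rowD.2.2.getD (j : ℕ) 0 * (tabs j).getD n 0 := by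
  decide +kernel

/-- **Row identity `f`.** [folklore] -/
theorem hrowF : ∀ n < 145, rowF.2.1 * tabTF.getD n 0 = ∑ j : Fin 43, rowF.2.2.getD (j : ℕ) 0 * (tabs j).getD n 0 := by
  decide +kernel

/-- `aₙ(φ₅₀ₐ|₁₀₀ ⊗ χ₋₄) = tabTD[n]`, `n < 145`. [cite: Shimura1971, Prop. 3.64] -/
theorem tabTD_eq_cuspCoeff : ∀ n < 145, ((tabTD.getD n 0 : ℤ) : ℂ) =
    cuspCoeffₗ (one_mem_strictPeriods_coe_gamma0 400) n (charTwist 400 (⟨4, rfl⟩ : 100 ∣ 400) (⟨25, rfl⟩ : 4 ^ 2 ∣ 400) isQuadratic_χ₄_ringHomComp RootFormsFifty.phiFiftyA) := by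
  intro n hn
  have hc : ((tabTD.getD n 0 : ℤ) : ℂ) = ((ZMod.χ₄ n : ℤ) : ℂ) * ((RootFormsFifty.t50a.getD n 0 : ℤ) : ℂ) := by exact_mod_cast hTwD n hn
  rw [cuspCoeffₗ_apply, cuspCoeff_charTwist 400 _ _ isQuadratic_χ₄_ringHomComp isPrimitive_χ₄_ringHomComp, χ₄_ringHomComp_apply_natCast,
    ← RootFormsFifty.t50a_eq_cuspCoeff n (by omega)]
  exact hc

/-- `aₙ(φ₅₀ᵦ|₁₀₀ ⊗ χ₋₄) = tabTF[n]`, `n < 145`. [cite: Shimura1971, Prop. 3.64] -/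
theorem tabTF_eq_cuspCoeff : ∀ n < 145, ((tabTF.getD n 0 : ℤ) : ℂ) =
    cuspCoeffₗ (one_mem_strictPeriods_coe_gamma0 400) n (charTwist 400 (⟨4, rfl⟩ : 100 ∣ 400) (⟨25, rfl⟩ : 4 ^ 2 ∣ 400) isQuadratic_χ₄_ringHomComp RootFormsFifty.phiFiftyB) := by
  intro n hn
  have hc : ((tabTF.getD n 0 : ℤ) : ℂ) = ((ZMod.χ₄ n : ℤ) : ℂ) * ((RootFormsFifty.t50b.getD n 0 : ℤ) : ℂ) := by exact_mod_cast hTwF n hn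
  rw [cuspCoeffₗ_apply, cuspCoeff_charTwist 400 _ _ isQuadratic_χ₄_ringHomComp isPrimitive_χ₄_ringHomComp, χ₄_ringHomComp_apply_natCast,
    ← RootFormsFifty.t50b_eq_cuspCoeff n (by omega)]
  exact hc

/-- **LEVEL 400: THE ROWS `d`, `f` re-rooted at `100`.** [cite: CremonaAlgorithms1997, §2.10, Table 1 (N = 400)] [cite: Shimura1971, Prop. 3.64] -/
theorem f_cases_DF (D : ModularParametrizationData W 400) :
    truth W [2, 5, 3, 7, 11, 13, 17] = rowA.1 ∨
    truth W [2, 5, 3, 7, 11, 13, 17] = rowB.1 ∨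
    truth W [2, 5, 3, 7, 11, 13, 17] = rowC.1 ∨
    (truth W [2, 5, 3, 7, 11, 13, 17] = rowD.1 ∧
      D.f = charTwist 400 (⟨4, rfl⟩ : 100 ∣ 400) (⟨25, rfl⟩ : 4 ^ 2 ∣ 400) isQuadratic_χ₄_ringHomComp RootFormsFifty.phiFiftyA) ∨
    truth W [2, 5, 3, 7, 11, 13, 17] = rowE.1 ∨
    (truth W [2, 5, 3, 7, 11, 13, 17] = rowF.1 ∧
      D.f = charTwist 400 (⟨4, rfl⟩ : 100 ∣ 400) (⟨25, rfl⟩ : 4 ^ 2 ∣ 400) isQuadratic_χ₄_ringHomComp RootFormsFifty.phiFiftyB) ∨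
    truth W [2, 5, 3, 7, 11, 13, 17] = rowG.1 ∨
    truth W [2, 5, 3, 7, 11, 13, 17] = rowH.1 := by
  haveI : FiniteDimensional ℂ (CuspForm (Gamma0 400) 2) := finiteDimensional_cuspForm_gamma0 400 2
  have hlen : ∀ i : Fin 43, (duals i).length ≤ 145 := by decide +kernel
  obtain ⟨S, C, hCS, hC, c, hc, htruth, hpinS, -⟩ := pinning_cusp D
  have ht := tables_of_etaCertsSparse 400 192 (fun i : Fin 43 ↦ expFn (Ls[(i : ℕ)]).1) (fun i ↦ shifts i) tabs C hC hshift hcert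
  have htS : ∀ i, ∀ n < 145, (((tabs i).getD n 0 : ℤ) : ℂ) = cuspCoeffₗ (one_mem_strictPeriods_coe_gamma0 400) n (S i) :=
    fun i n hn ↦ by rw [cuspCoeffₗ_apply, ← modCoefₗ_modularForm (S i) n, hCS]; exact ht i n (by omega)
  rw [stages_map_fst] at htruth
  rw [goodCerts_eq_rows] at hc
  simp only [List.mem_cons, List.mem_nil_iff, or_false] at hc
  rcases hc with rfl | rfl | rfl | rfl | rfl | rfl | rfl | rfl
  · exact Or.inl htruth
  · exact Or.inr (Or.inl htruth)
  · exact Or.inr (Or.inr (Or.inl htruth))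
  · exact Or.inr (Or.inr (Or.inr (Or.inl ⟨htruth, eq_of_smul_eq_sum_of_row S tabs duals 720 htS hlen hdual (by norm_num) finrank_cuspForm_two _
      tabTD tabTD_eq_cuspCoeff rowD.2.1 (by decide) rowD.2.2 hpinS hrowD⟩)))
  · exact Or.inr (Or.inr (Or.inr (Or.inr (Or.inl htruth))))
  · exact Or.inr (Or.inr (Or.inr (Or.inr (Or.inr (Or.inl ⟨htruth, eq_of_smul_eq_sum_of_row S tabs duals 720 htS hlen hdual (by norm_num) finrank_cuspForm_two _
      tabTF tabTF_eq_cuspCoeff rowF.2.1 (by decide) rowF.2.2 hpinS hrowF⟩)))))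
  · exact Or.inr (Or.inr (Or.inr (Or.inr (Or.inr (Or.inr (Or.inl htruth))))))
  · exact Or.inr (Or.inr (Or.inr (Or.inr (Or.inr (Or.inr (Or.inr (htruth)))))))

/-- **Row `d` selected by `a₃(W) = −1`**: `D.f = φ₅₀ₐ|₁₀₀ ⊗ χ₋₄`. [cite: CremonaAlgorithms1997, Table 1 (N = 400)] -/
theorem f_eq_charTwist_phiFiftyA_of_lFunction_three (D : ModularParametrizationData W 400) (h3 : W.LFunction 3 = -1) :
    D.f = charTwist 400 (⟨4, rfl⟩ : 100 ∣ 400) (⟨25, rfl⟩ : 4 ^ 2 ∣ 400) isQuadratic_χ₄_ringHomComp RootFormsFifty.phiFiftyA := by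
  rcases f_cases_DF D with h | h | h | ⟨h, hf⟩ | h | ⟨h, hf⟩ | h | h
  · have h' := (key_truth rowA h).1; rw [h3] at h'; simp [rowA] at h'
  · have h' := (key_truth rowB h).1; rw [h3] at h'; simp [rowB] at h'
  · have h' := (key_truth rowC h).1; rw [h3] at h'; simp [rowC] at h'
  · exact hf
  · have h' := (key_truth rowE h).1; rw [h3] at h'; simp [rowE] at h'
  · have h' := (key_truth rowF h).1; rw [h3] at h'; simp [rowF] at h'
  · have h' := (key_truth rowG h).1; rw [h3] at h'; simp [rowG] at h'
  · have h' := (key_truth rowH h).1; rw [h3] at h'; simp [rowH] at h'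

/-- **Row `f` selected by `a₃(W) = 1`**: `D.f = φ₅₀ᵦ|₁₀₀ ⊗ χ₋₄`. [cite: CremonaAlgorithms1997, Table 1 (N = 400)] -/
theorem f_eq_charTwist_phiFiftyB_of_lFunction_three (D : ModularParametrizationData W 400) (h3 : W.LFunction 3 = 1) :
    D.f = charTwist 400 (⟨4, rfl⟩ : 100 ∣ 400) (⟨25, rfl⟩ : 4 ^ 2 ∣ 400) isQuadratic_χ₄_ringHomComp RootFormsFifty.phiFiftyB := by
  rcases f_cases_DF D with h | h | h | ⟨h, hf⟩ | h | ⟨h, hf⟩ | h | h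
  · have h' := (key_truth rowA h).1; rw [h3] at h'; simp [rowA] at h'
  · have h' := (key_truth rowB h).1; rw [h3] at h'; simp [rowB] at h'
  · have h' := (key_truth rowC h).1; rw [h3] at h'; simp [rowC] at h'
  · have h' := (key_truth rowD h).1; rw [h3] at h'; simp [rowD] at h'
  · have h' := (key_truth rowE h).1; rw [h3] at h'; simp [rowE] at h'
  · exact hf
  · have h' := (key_truth rowG h).1; rw [h3] at h'; simp [rowG] at h'
  · have h' := (key_truth rowH h).1; rw [h3] at h'; simp [rowH] at h'

/-! ## §2 The aligned minimal models -/

/-- The unit `½ ∈ ℚˣ`. [folklore] -/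
def uHalf : ℚˣ := ⟨1 / 2, 2, by norm_num, by norm_num⟩

/-- **ALIGNED EDGE `50a1 ⊗ (−1) → C_d = [0, -1, 0, -8, 112]`.** [cite: CremonaAlgorithms1997, Table 1 (50a1, N = 400)] -/
theorem smul_quadraticTwist_fiftyA1_negOne :
    (⟨uHalf, 0, 0, 0⟩ : VariableChange ℚ) • (⟨1, 0, 1, -1, -2⟩ : WeierstrassCurve ℚ).quadraticTwist ((-1 : ℤ) : ℚ) = ⟨0, -1, 0, -8, 112⟩ := by
  ext <;> simp only [variableChange_a₁, variableChange_a₂, variableChange_a₃, variableChange_a₄, variableChange_a₆,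
    quadraticTwist_a₁, quadraticTwist_a₂, quadraticTwist_a₃, quadraticTwist_a₄, quadraticTwist_a₆, b₂, b₄, b₆, uHalf] <;> norm_num

/-- **ALIGNED EDGE `50b1 ⊗ (−1) → C_f = [0, 1, 0, -48, -172]`.** [cite: CremonaAlgorithms1997, Table 1 (50b1, N = 400)] -/
theorem smul_quadraticTwist_fiftyB1_negOne :
    (⟨uHalf, 1 / 2, 0, 0⟩ : VariableChange ℚ) • (⟨1, 1, 1, -3, 1⟩ : WeierstrassCurve ℚ).quadraticTwist ((-1 : ℤ) : ℚ) = ⟨0, 1, 0, -48, -172⟩ := by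
  ext <;> simp only [variableChange_a₁, variableChange_a₂, variableChange_a₃, variableChange_a₄, variableChange_a₆,
    quadraticTwist_a₁, quadraticTwist_a₂, quadraticTwist_a₃, quadraticTwist_a₄, quadraticTwist_a₆, b₂, b₄, b₆, uHalf] <;> norm_num

/-- `(½)¹²·Δ(C_d) = Δ(50a1)`. [folklore] -/
theorem Δ_Cd_eq : ((1 / 2 : ℚ)) ^ 12 * (⟨0, -1, 0, -8, 112⟩ : WeierstrassCurve ℚ).Δ = (((-1 : ℤ) : ℚ)) ^ 6 * (⟨1, 0, 1, -1, -2⟩ : WeierstrassCurve ℚ).Δ := by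
  norm_num [WeierstrassCurve.Δ, WeierstrassCurve.b₂, WeierstrassCurve.b₄, WeierstrassCurve.b₆, WeierstrassCurve.b₈]

/-- `(½)¹²·Δ(C_f) = Δ(50b1)`. [folklore] -/
theorem Δ_Cf_eq : ((1 / 2 : ℚ)) ^ 12 * (⟨0, 1, 0, -48, -172⟩ : WeierstrassCurve ℚ).Δ = (((-1 : ℤ) : ℚ)) ^ 6 * (⟨1, 1, 1, -3, 1⟩ : WeierstrassCurve ℚ).Δ := by
  norm_num [WeierstrassCurve.Δ, WeierstrassCurve.b₂, WeierstrassCurve.b₄, WeierstrassCurve.b₆, WeierstrassCurve.b₈]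

/-- `C_d` is an elliptic curve. [folklore] -/
theorem isElliptic_Cd : (⟨0, -1, 0, -8, 112⟩ : WeierstrassCurve ℚ).IsElliptic :=
  ⟨by norm_num [WeierstrassCurve.Δ, WeierstrassCurve.b₂, WeierstrassCurve.b₄, WeierstrassCurve.b₆, WeierstrassCurve.b₈]⟩

/-- `C_f` is an elliptic curve. [folklore] -/
theorem isElliptic_Cf : (⟨0, 1, 0, -48, -172⟩ : WeierstrassCurve ℚ).IsElliptic :=
  ⟨by norm_num [WeierstrassCurve.Δ, WeierstrassCurve.b₂, WeierstrassCurve.b₄, WeierstrassCurve.b₆, WeierstrassCurve.b₈]⟩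

/-- **`C_d` is globally minimal** (Kraus certificate at `2`; at `5`: `v₅(Δ) < 12`). [cite: Kraus1989, Prop. 2] [cite: SilvermanAEC2009, VII.1 Remark 1.1] -/
theorem isGloballyMinimal_Cd : (⟨0, -1, 0, -8, 112⟩ : WeierstrassCurve ℚ).IsGloballyMinimal := by
  rw [show (⟨0, -1, 0, -8, 112⟩ : WeierstrassCurve ℚ) = ⟨((0 : ℤ) : ℚ), ((-1 : ℤ) : ℚ), ((0 : ℤ) : ℚ), ((-8 : ℤ) : ℚ), ((112 : ℤ) : ℚ)⟩ by
    ext <;> norm_num, ← IntModelTam.baseChange_rat_mk_int]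
  exact isGloballyMinimal_of_krausCheck (W₀ := ⟨0, -1, 0, -8, 112⟩) (c := ⟨13, 4, 6, [⟨5, 2, 4, 0, 0⟩]⟩) (by decide +kernel)

/-- **`C_f` is globally minimal** (Kraus certificate). [cite: Kraus1989, Prop. 2] [cite: SilvermanAEC2009, VII.1 Remark 1.1] -/
theorem isGloballyMinimal_Cf : (⟨0, 1, 0, -48, -172⟩ : WeierstrassCurve ℚ).IsGloballyMinimal := by
  rw [show (⟨0, 1, 0, -48, -172⟩ : WeierstrassCurve ℚ) = ⟨((0 : ℤ) : ℚ), ((1 : ℤ) : ℚ), ((0 : ℤ) : ℚ), ((-48 : ℤ) : ℚ), ((-172 : ℤ) : ℚ)⟩ by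
    ext <;> norm_num, ← IntModelTam.baseChange_rat_mk_int]
  exact isGloballyMinimal_of_krausCheck (W₀ := ⟨0, 1, 0, -48, -172⟩) (c := ⟨17, 4, 6, [⟨5, 2, 2, 0, 0⟩]⟩) (by decide +kernel)

/-! ## §3 The `r = ½` transport at `M = 100` and the headlines -/

/-- **The `r = ½` transport for a root good or multiplicative at `2`, root level `100`** (Stevens (5.4) + Pal + p3's Néron squeeze).
[cite: Stevens1989, Lemma (5.4) p. 97] [cite: Pal2012, Lemma 3.1] [cite: AgasheRibetStein2006, §§1–2] -/
theorem abs_maninConstant_eq_one_of_negOneTwist_rHalf_hundred (f₀ : CuspForm (Gamma0 100) 2)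
    (W₀ : WeierstrassCurve ℚ) [W₀.IsElliptic] (L₀ : PeriodPair) (hL₀ : IsNeronLatticeOf (W₀.baseChange ℂ) L₀)
    (hS0 : ∀ z ∈ periodLattice f₀, z ∈ L₀.lattice)
    (C : WeierstrassCurve ℚ) [C.IsElliptic] [C.IsGloballyMinimal] (u : VariableChange ℚ)
    (hu : u • W₀.quadraticTwist ((-1 : ℤ) : ℚ) = C) (hΔ : ((1 / 2 : ℚ)) ^ 12 * C.Δ = (((-1 : ℤ) : ℚ)) ^ 6 * W₀.Δ)
    (W : WeierstrassCurve ℚ) [W.IsElliptic] [W.IsGloballyMinimal] (D : ModularParametrizationData W 400)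
    (hf : D.f = charTwist 400 (⟨4, rfl⟩ : 100 ∣ 400) (⟨25, rfl⟩ : 4 ^ 2 ∣ 400) isQuadratic_χ₄_ringHomComp f₀)
    (hopt : ∀ z ∈ D.L.lattice, ∃ w ∈ periodLattice D.f, z = D.c * w) : |D.maninConstant| = 1 := by
  obtain ⟨LC, hLC⟩ := exists_isNeronLatticeOf_holds (C.baseChange ℂ)
  set g : ℂ := gaussSum (ZMod.χ₄.ringHomComp (Int.castRingHom ℂ)) (ZMod.stdAddChar (N := 4)) with hg
  have hs : (g / 2) ^ 2 = ((((-1 : ℤ) : ℚ)) : ℂ) := by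
    rw [div_pow, gaussSum_χ₄_ringHomComp_sq]; norm_num
  have hle : ∀ w ∈ periodLattice D.f, w ∈ LC.lattice := by
    intro w hw
    rw [hf] at hw
    have hgw : g * w ∈ L₀.lattice :=
      hS0 _ (gaussSum_mul_mem_periodLattice_of_mem_charTwist 400 (⟨4, rfl⟩ : 100 ∣ 400) (⟨25, rfl⟩ : 4 ^ 2 ∣ 400)
        isQuadratic_χ₄_ringHomComp isPrimitive_χ₄_ringHomComp f₀ hw)
    rw [neronLattice_mem_iff_of_twist_of_sq_eq (W := W₀) (by norm_num) u hu (r := 1 / 2) hΔ hs hL₀ hLC w]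
    convert hgw using 1
    push_cast
    ring
  exact NeronSqueeze.abs_maninConstant_eq_one_of_periodLattice_le C LC hLC W D hle hopt

/-- **`|c| = 1` ON THE ROW `50a ⊗ χ₋₄` OF LEVEL 400** (`a₃(W) = −1`). [cite: AgasheRibetStein2006, §§1–2] [cite: CremonaAlgorithms1997, Table 1 (N = 400)] -/
theorem abs_maninConstant_eq_one_fourHundred_of_lFunction_three_eq_neg_one (W : WeierstrassCurve ℚ) [W.IsElliptic] [W.IsGloballyMinimal]
    (D : ModularParametrizationData W 400) (h3 : W.LFunction 3 = -1)
    (hopt : ∀ z ∈ D.L.lattice, ∃ w ∈ periodLattice D.f, z = D.c * w) : |D.maninConstant| = 1 := by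
  obtain ⟨L₀, hL₀, hS0⟩ := RootFormsFifty.exists_neron_squeeze_phiFiftyA
  haveI := RootFormsFifty.isElliptic_fiftyA1
  haveI := isElliptic_Cd
  haveI := isGloballyMinimal_Cd
  exact abs_maninConstant_eq_one_of_negOneTwist_rHalf_hundred RootFormsFifty.phiFiftyA (⟨1, 0, 1, -1, -2⟩ : WeierstrassCurve ℚ) L₀ hL₀ hS0
    (⟨0, -1, 0, -8, 112⟩ : WeierstrassCurve ℚ) ⟨uHalf, 0, 0, 0⟩ smul_quadraticTwist_fiftyA1_negOne Δ_Cd_eq W D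
    (f_eq_charTwist_phiFiftyA_of_lFunction_three D h3) hopt

/-- **`|c| = 1` ON THE ROW `50b ⊗ χ₋₄` OF LEVEL 400** (`a₃(W) = 1`). [cite: AgasheRibetStein2006, §§1–2] [cite: CremonaAlgorithms1997, Table 1 (N = 400)] -/
theorem abs_maninConstant_eq_one_fourHundred_of_lFunction_three_eq_one (W : WeierstrassCurve ℚ) [W.IsElliptic] [W.IsGloballyMinimal]
    (D : ModularParametrizationData W 400) (h3 : W.LFunction 3 = 1)
    (hopt : ∀ z ∈ D.L.lattice, ∃ w ∈ periodLattice D.f, z = D.c * w) : |D.maninConstant| = 1 := by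
  obtain ⟨L₀, hL₀, hS0⟩ := RootFormsFifty.exists_neron_squeeze_phiFiftyB
  haveI := RootFormsFifty.isElliptic_fiftyB1
  haveI := isElliptic_Cf
  haveI := isGloballyMinimal_Cf
  exact abs_maninConstant_eq_one_of_negOneTwist_rHalf_hundred RootFormsFifty.phiFiftyB (⟨1, 1, 1, -3, 1⟩ : WeierstrassCurve ℚ) L₀ hL₀ hS0
    (⟨0, 1, 0, -48, -172⟩ : WeierstrassCurve ℚ) ⟨uHalf, 1 / 2, 0, 0⟩ smul_quadraticTwist_fiftyB1_negOne Δ_Cf_eq W D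
    (f_eq_charTwist_phiFiftyB_of_lFunction_three D h3) hopt

/-! ## §4 Four of the eight classes of level `400` -/

/-- **`|c| = 1` on the FOUR transported classes of level 400** (`a₃(W) ∈ {−1, 0, 1}`, or `(a₃, a₇) = (−2, 2)`). [cite: AgasheRibetStein2006, §§1–2] -/
theorem abs_maninConstant_eq_one_fourHundred_of_rowCDEF (W : WeierstrassCurve ℚ) [W.IsElliptic] [W.IsGloballyMinimal]
    (D : ModularParametrizationData W 400)
    (h : W.LFunction 3 = -1 ∨ W.LFunction 3 = 0 ∨ W.LFunction 3 = 1 ∨ (W.LFunction 3 = -2 ∧ W.LFunction 7 = 2))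
    (hopt : ∀ z ∈ D.L.lattice, ∃ w ∈ periodLattice D.f, z = D.c * w) : |D.maninConstant| = 1 := by
  rcases h with h3 | h3 | h3 | ⟨h3, h7⟩
  · exact abs_maninConstant_eq_one_fourHundred_of_lFunction_three_eq_neg_one W D h3 hopt
  · exact abs_maninConstant_eq_one_fourHundred_of_lFunction_three_eq_zero W D h3 hopt
  · exact abs_maninConstant_eq_one_fourHundred_of_lFunction_three_eq_one W D h3 hopt
  · exact abs_maninConstant_eq_one_fourHundred_of_lFunction_three_seven W D h3 h7 hopt

/-- **No integer `q` with `|q| ≠ 1` — in particular neither `2` nor `5` — divides `c` on the four classes.** [folklore] -/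
theorem not_dvd_maninConstant_fourHundred_of_rowCDEF (W : WeierstrassCurve ℚ) [W.IsElliptic] [W.IsGloballyMinimal]
    (D : ModularParametrizationData W 400)
    (h : W.LFunction 3 = -1 ∨ W.LFunction 3 = 0 ∨ W.LFunction 3 = 1 ∨ (W.LFunction 3 = -2 ∧ W.LFunction 7 = 2))
    (hopt : ∀ z ∈ D.L.lattice, ∃ w ∈ periodLattice D.f, z = D.c * w) {q : ℤ} (hq : q.natAbs ≠ 1) : ¬ q ∣ D.maninConstant := by
  intro hd
  have h1 := abs_maninConstant_eq_one_fourHundred_of_rowCDEF W D h hopt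
  have hn : D.maninConstant.natAbs = 1 := by
    rw [Int.abs_eq_natAbs] at h1
    exact_mod_cast h1
  have h2 : q.natAbs ∣ 1 := hn ▸ Int.natAbs_dvd_natAbs.mpr hd
  exact hq (Nat.dvd_one.mp h2)

/-- **`2 ∤ c` on the four classes** — the body of C2 `ManinOddAtFour` at `N = 400` there. [cite: AgasheRibetStein2006, §§1–2] -/
theorem not_two_dvd_maninConstant_fourHundred_of_rowCDEF (W : WeierstrassCurve ℚ) [W.IsElliptic] [W.IsGloballyMinimal]
    (D : ModularParametrizationData W 400)
    (h : W.LFunction 3 = -1 ∨ W.LFunction 3 = 0 ∨ W.LFunction 3 = 1 ∨ (W.LFunction 3 = -2 ∧ W.LFunction 7 = 2))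
    (hopt : ∀ z ∈ D.L.lattice, ∃ w ∈ periodLattice D.f, z = D.c * w) : ¬ (2 : ℤ) ∣ D.maninConstant :=
  not_dvd_maninConstant_fourHundred_of_rowCDEF W D h hopt (by decide)

/-- **`5 ∤ c` on the four classes** (the residual conjunct's body at `p = 5`, `5² ∣ 400`, there). [cite: AgasheRibetStein2006, §§1–2] -/
theorem not_five_dvd_maninConstant_fourHundred_of_rowCDEF (W : WeierstrassCurve ℚ) [W.IsElliptic] [W.IsGloballyMinimal]
    (D : ModularParametrizationData W 400)
    (h : W.LFunction 3 = -1 ∨ W.LFunction 3 = 0 ∨ W.LFunction 3 = 1 ∨ (W.LFunction 3 = -2 ∧ W.LFunction 7 = 2))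
    (hopt : ∀ z ∈ D.L.lattice, ∃ w ∈ periodLattice D.f, z = D.c * w) : ¬ (5 : ℤ) ∣ D.maninConstant :=
  not_dvd_maninConstant_fourHundred_of_rowCDEF W D h hopt (by decide)

end Summit.BirchSwinnertonDyer.BirchSwinnertonDyer.Theorems.ManinLocalTwoThree.LevelFourHundred

end
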